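import Literature.Probability.Percolation.SharpnessDCTProofs
import Literature.Probability.Percolation.RSW
import Summits.CriticalPhenomena.CardyFormulaZ2.Theorems.CardyBoundaryCoulombGasBoundaryDefectGaussianRStubRealisabilityPart26

/-!
# The `(2;2)` member of rainbow locality — Part 3: restricted connection probabilities of critical
# bond percolation are counts over sets of induced edges (crux `BoundaryDefectGaussianR`,
# stmt-CriticalPhenomena-14132; line `rainbow-monomials-in-excursion-kernels`)

The bridge between the insertion dictionary (a COUNT `‖Zins V ι‖ = #{ω ⊆ E : Rainbow}` over sets of
induced edges `E = inducedEdges V` of `V ⊂ ℤ × ℤ`, coded as `(u, dir)`) and the percolation half of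
cluster locality (a PROBABILITY under critical bond percolation `P_{1/2}` on `ℤ²`, sites `Fin 2 → ℤ`):
for `u, w ∈ ℤ × ℤ`,

  `P_{1/2}[u ↔ w in V] = 2^{-|E|} · #{ω ⊆ E : u ↔ w by edges of ω inside V}`

(`s18_rainbow22_bridge`, registered), where `u ↔ w in V` is `openConnIn` of the site image of `V` and
a set `ω` of coded edges is read as the lattice configuration `ω.image edgeSym2`.

Proof (`r22_prob_eq_card`). `P_{1/2}` is carried by lattice configurations (`ae_subset_edgeSet`), on
which the event only reads the lattice edges with both endpoints in `V` (`DCT16.determinedBy_openConnIn`;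
such an edge is `edgeSym2 e` of an induced edge `e`, `r22_mem_image_inducedEdges`), i.e. it agrees with
the event `{ω' | ω' ∩ F ∈ ·}`, `F = E.image edgeSym2`, determined by `F`; the probability of the latter is
Russo's cylinder polynomial (`Russo.measureReal_eq_cylPoly`) all of whose weights are `1/2`, i.e.
`2^{-|F|} · #{T ⊆ F : T ∈ ·}`, and `T ↦` its set of coded edges is a bijection with `{ω ⊆ E : …}`
(`edgeSym2` is injective). All [folklore]; no new objects.
-/

noncomputable section

namespace Summit.CriticalPhenomena.CardyFormulaZ2.Cruxes.BoundaryDefectGaussianR.RainbowMonomialsInExcursionKernels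

open MeasureTheory Finset Literature.Probability.LatticeModels Literature.Probability.LatticeModels.CollarLegModel
open Literature.Probability.Percolation

/-! ### Lattice edges inside `V` are the coded induced edges -/

/-- A coded edge, read as a lattice edge, is an edge of `ℤ²`. [folklore] -/
theorem r22_edgeSym2_mem_edgeSet (e : (ℤ × ℤ) × Bool) : edgeSym2 e ∈ (zdGraph 2).edgeSet := by
  rw [← cTgt_cIn e]; exact cTgt_mem_edgeSet _

/-- **A lattice edge with both endpoints in `V` is (the reading of) an induced edge of `V`.** [folklore] -/
theorem r22_mem_image_inducedEdges {V : Finset (ℤ × ℤ)} {s : Sym2 (Site 2)} (hs : s ∈ (zdGraph 2).edgeSet)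
    (hV : ∀ z ∈ s, z ∈ (↑(V.image toSite) : Set (Site 2))) : s ∈ (inducedEdges V).image edgeSym2 := by
  induction s using Sym2.ind with
  | h a b =>
    have hadj : (zdGraph 2).Adj a b := hs
    obtain ⟨k, rfl⟩ := exists_eq_add_cornerUnit hadj
    have ha := hV a (Sym2.mem_mk_left _ _)
    have hb := hV _ (Sym2.mem_mk_right _ _)
    rw [Finset.mem_coe, mem_image] at ha hb
    obtain ⟨v, hv, rfl⟩ := ha
    obtain ⟨v', hv', hvv'⟩ := hb
    rw [← se_toSite_add_dir] at hvv'
    have hv'eq : v' = v + dir k := toSite_inj.1 hvv'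
    subst hv'eq
    -- the coded edge at the end of the corner `(toSite v, k + 3)`
    have hK : k + 3 + 1 = k := by fin_cases k <;> rfl
    obtain ⟨e, hc, hend⟩ := se_corner_edge v (k + 3)
    rw [hK] at hend
    have hEq : edgeSym2 e = s(toSite v, toSite v + cornerUnit k) := by
      have : cTgt (toSite v, k + 3) = s(toSite v, toSite v + cornerUnit k) := by rw [cTgt, hK]
      rw [← this]
      rcases hc with hc | hc
      · rw [hc, cTgt_cIn]
      · rw [hc, cTgt_cOut]
    refine mem_image.2 ⟨e, ?_, hEq⟩
    have hends : e.1 ∈ V ∧ SixVertex.edgeTip e ∈ V := by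
      rcases hend with ⟨h1, h2⟩ | ⟨h1, h2⟩
      · rw [h1, h2]; exact ⟨hv, hv'⟩
      · rw [h1, h2]; exact ⟨hv', hv⟩
    rw [inducedEdges, mem_filter]
    refine ⟨?_, hends⟩
    rw [SixVertex.edges, mem_biUnion]
    refine ⟨e.1, hends.1, ?_⟩
    obtain ⟨e1, b⟩ := e
    cases b <;> simp [SixVertex.vertexEdges]

/-! ### The count -/

/-- **Restricted connection probabilities are counts over induced edges.** For `V ⊂ ℤ × ℤ` finite and
`u, w ∈ ℤ × ℤ`: `P_{1/2}[u ↔ w in V] = #{ω ⊆ inducedEdges V : u ↔ w by edges of ω inside V} / 2^{|E|}`.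
[folklore] -/
theorem r22_prob_eq_card (V : Finset (ℤ × ℤ)) (u w : ℤ × ℤ)
    [DecidablePred fun ω : Finset ((ℤ × ℤ) × Bool) => (↑(ω.image edgeSym2) : Set (Sym2 (Site 2))) ∈
      openConnIn (↑(V.image toSite) : Set (Site 2)) (toSite u) (toSite w)] :
    (bondPercolation (zdGraph 2) half).real (openConnIn (↑(V.image toSite) : Set (Site 2)) (toSite u) (toSite w)) =
      (((inducedEdges V).powerset.filter (fun ω => (↑(ω.image edgeSym2) : Set (Sym2 (Site 2))) ∈
        openConnIn (↑(V.image toSite) : Set (Site 2)) (toSite u) (toSite w))).card : ℝ) /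
        2 ^ (inducedEdges V).card := by
  -- no `classical`: the statement's instance must be the one of the final `filter`
  haveI hdA : ∀ B : Set (BondConfig (Site 2)), DecidablePred fun T : Finset (Sym2 (Site 2)) =>
      (↑T : Set (Sym2 (Site 2))) ∈ B := fun B => Classical.decPred _
  let S : Set (Site 2) := ↑(V.image toSite)
  let A : Set (BondConfig (Site 2)) := openConnIn S (toSite u) (toSite w)
  set E := inducedEdges V with hE
  set F : Finset (Sym2 (Site 2)) := E.image edgeSym2 with hF
  let A' : Set (BondConfig (Site 2)) := {ω' | ω' ∩ ↑F ∈ A}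
  have hFE : (↑F : Set (Sym2 (Site 2))) ⊆ (zdGraph 2).edgeSet := by
    intro s hs
    rw [hF, Finset.coe_image] at hs
    obtain ⟨e, -, rfl⟩ := hs
    exact r22_edgeSym2_mem_edgeSet e
  -- (1) on lattice configurations the event reads only `F`
  have hagree : ∀ ω' : BondConfig (Site 2), ω' ⊆ (zdGraph 2).edgeSet → (ω' ∈ A ↔ ω' ∈ A') := by
    intro ω' hω'
    have hdet := DCT16.determinedBy_openConnIn S (toSite u) (toSite w) (K := S.sym2) le_rfl
    rw [determinedBy_iff] at hdet
    refine hdet ω' (ω' ∩ ↑F) ?_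
    ext s
    simp only [Set.mem_inter_iff]
    constructor
    · rintro ⟨hs, hs2⟩
      refine ⟨⟨hs, ?_⟩, hs2⟩
      rw [Finset.mem_coe, hF]
      exact r22_mem_image_inducedEdges (hω' hs) fun z hz => Set.mem_sym2_iff_subset.1 hs2 hz
    · rintro ⟨⟨hs, -⟩, hs2⟩; exact ⟨hs, hs2⟩
  have hae : A =ᵐ[bondPercolation (zdGraph 2) half] A' := by
    filter_upwards [ae_subset_edgeSet (zdGraph 2) half] with ω' hω'
    exact propext (hagree ω' hω')
  -- (2) the agreeing event is determined by `F`; its probability is the cylinder polynomial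
  have hdet' : DeterminedBy A' (↑F : Set (Sym2 (Site 2))) := by
    rw [determinedBy_iff]
    intro ω₁ ω₂ h
    simp only [A', Set.mem_setOf_eq, h]
  have hhalf : ((half : unitInterval) : ℝ) = 1 / 2 := coe_half
  have hcyl : (bondPercolation (zdGraph 2) half).real A' =
      ∑ T ∈ F.powerset, if ((T : Finset (Sym2 (Site 2))) : Set (Sym2 (Site 2))) ∈ A' then ((2 : ℝ) ^ F.card)⁻¹ else 0 := by
    rw [bondPercolation, Russo.measureReal_eq_cylPoly hdet', Russo.cylPoly]
    refine sum_congr rfl fun T hT => ?_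
    by_cases h : ((T : Finset (Sym2 (Site 2))) : Set (Sym2 (Site 2))) ∈ A'
    · rw [if_pos h, if_pos h, ← inv_pow, prod_eq_pow_card (b := (2 : ℝ)⁻¹)]
      intro i hi
      have hiE : i ∈ (zdGraph 2).edgeSet := hFE (Finset.mem_coe.2 hi)
      unfold Russo.weight
      rw [hhalf]
      split_ifs <;> norm_num
    · rw [if_neg h, if_neg h]
  -- (3) on `T ⊆ F`, membership in `A'` is membership in `A`
  have hfilt : F.powerset.filter (fun T : Finset (Sym2 (Site 2)) => (↑T : Set (Sym2 (Site 2))) ∈ A') =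
      F.powerset.filter (fun T : Finset (Sym2 (Site 2)) => (↑T : Set (Sym2 (Site 2))) ∈ A) := by
    refine filter_congr fun T hT => ?_
    rw [mem_powerset] at hT
    simp only [A', Set.mem_setOf_eq]
    rw [Set.inter_eq_left.2 (Finset.coe_subset.2 hT)]
  -- (4) `ω ↦ ω.image edgeSym2` is a bijection from `{ω ⊆ E : …}` onto `{T ⊆ F : T ∈ A}`
  have himage : F.powerset.filter (fun T : Finset (Sym2 (Site 2)) => (↑T : Set (Sym2 (Site 2))) ∈ A) =
      (E.powerset.filter (fun ω => (↑(ω.image edgeSym2) : Set (Sym2 (Site 2))) ∈ A)).image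
        (fun ω => ω.image edgeSym2) := by
    ext T
    simp only [mem_filter, mem_powerset, mem_image]
    constructor
    · rintro ⟨hT, hTA⟩
      have hEq : (E.filter (fun e => edgeSym2 e ∈ T)).image edgeSym2 = T := by
        ext s
        simp only [mem_image, mem_filter]
        constructor
        · rintro ⟨e, ⟨-, he⟩, rfl⟩; exact he
        · intro hs
          have hs' := hT hs
          rw [hF, mem_image] at hs'
          obtain ⟨e, he, rfl⟩ := hs'
          exact ⟨e, ⟨he, hs⟩, rfl⟩
      refine ⟨E.filter (fun e => edgeSym2 e ∈ T), ⟨filter_subset _ _, ?_⟩, hEq⟩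
      rw [hEq]; exact hTA
    · rintro ⟨ω, ⟨hω, hωA⟩, rfl⟩
      exact ⟨image_subset_image hω, hωA⟩
  have hinj : Function.Injective (fun ω : Finset ((ℤ × ℤ) × Bool) => ω.image edgeSym2) :=
    Finset.image_injective edgeSym2_injective
  have hcardF : F.card = E.card := card_image_of_injective _ edgeSym2_injective
  -- assemble
  rw [measureReal_congr hae, hcyl, ← sum_filter, sum_const, hfilt, himage, card_image_of_injective _ hinj,
    hcardF, nsmul_eq_mul, div_eq_mul_inv]
  congr 3
  ext ω
  simp only [mem_filter]
  exact Iff.rfl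


/-! ### Registered one-line form -/

/-- **Sub-goal `s18_rainbow22_bridge`** (registered on stmt-CriticalPhenomena-14132; Part 3 of the `(2;2)`
member of rainbow locality): the critical bond-percolation probability of `{u ↔ w in V}` is the number of
sets of induced edges of `V` joining `u` to `w` inside `V`, divided by `2^{|inducedEdges V|}`
(`r22_prob_eq_card` in the `![·, ·]` phrasing of the stubs). [folklore] -/
theorem s18_rainbow22_bridge : ∀ (V : Finset (ℤ × ℤ)) (u w : ℤ × ℤ) [DecidablePred fun ω : Finset ((ℤ × ℤ) × Bool) => (↑(ω.image Literature.Probability.LatticeModels.CollarLegModel.edgeSym2) : Set (Sym2 (Fin 2 → ℤ))) ∈ Literature.Probability.Percolation.openConnIn (↑(V.image (fun v : ℤ × ℤ => (![v.1, v.2] : Fin 2 → ℤ))) : Set (Fin 2 → ℤ)) (![u.1, u.2] : Fin 2 → ℤ) (![w.1, w.2] : Fin 2 → ℤ)], (Literature.Probability.Percolation.bondPercolation (Literature.Probability.LatticeModels.zdGraph 2) Literature.Probability.Percolation.half).real (Literature.Probability.Percolation.openConnIn (↑(V.image (fun v : ℤ × ℤ => (![v.1, v.2] : Fin 2 → ℤ)))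 : Set (Fin 2 → ℤ)) (![u.1, u.2] : Fin 2 → ℤ) (![w.1, w.2] : Fin 2 → ℤ)) = ((((Literature.Probability.LatticeModels.CollarLegModel.inducedEdges V).powerset.filter (fun ω => (↑(ω.image Literature.Probability.LatticeModels.CollarLegModel.edgeSym2) : Set (Sym2 (Fin 2 → ℤ))) ∈ Literature.Probability.Percolation.openConnIn (↑(V.image (fun v : ℤ × ℤ => (![v.1, v.2] : Fin 2 → ℤ))) : Set (Fin 2 → ℤ)) (![u.1, u.2] : Fin 2 → ℤ) (![w.1, w.2] : Fin 2 → ℤ))).card : ℕ) : ℝ) / 2 ^ (Literature.Probability.LatticeModels.CollarLegModel.inducedEdges V).card :=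
  fun V u w inst => @r22_prob_eq_card V u w inst

end Summit.CriticalPhenomena.CardyFormulaZ2.Cruxes.BoundaryDefectGaussianR.RainbowMonomialsInExcursionKernels

end
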